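import Summits.BirchSwinnertonDyer.BirchSwinnertonDyer.Theorems.SchneiderFreeAdditiveX3AnticycControlAdditivePtSurjLift
import Summits.BirchSwinnertonDyer.BirchSwinnertonDyer.Theorems.SchneiderFreeAdditiveX3AnticycControlAdditiveOfTorsAtoms
import Summits.BirchSwinnertonDyer.BirchSwinnertonDyer.Theorems.SchneiderFreeAdditiveX3AnticycControlAdditiveStubNoLocalPTorsionOfAtoms
import Summits.BirchSwinnertonDyer.Rank1Residual.X11b.RouteR1LocSurj
import Summits.BirchSwinnertonDyer.Rank1Residual.X11b.RouteR1Coinvariants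
import Summits.BirchSwinnertonDyer.Rank1Residual.X11b.RelaxedSelmerFinite
import Summits.BirchSwinnertonDyer.Rank1Residual.X11b.LocalPrimaryCohomologyEP
import Summits.BirchSwinnertonDyer.Rank1Residual.X11b.BDPRouteLocalKernelAtPPadic
import Summits.BirchSwinnertonDyer.Rank1Residual.X11b.BDPRouteLocalKernelAtP
import Summits.BirchSwinnertonDyer.Rank1Residual.X11b.AnticyclotomicEmbedding
import HarnessLib

/-!
# Crux `AnticycControlAdditiveK` (route `SchneiderFreeAdditiveX3`, item stmt-BirchSwinnertonDyer-19295),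
# stub `stub_ptSurj` (P9-𝓒): Poitou–Tate surjectivity at EVERY frame (any global torsion `g`, any
# local torsion `t`) — part 2: (P9⁺)/(P9)/(P9-𝓒) and the registered stub modulo the cited facts

Seat `bsd-schneider-door-c6` (cell `bsd-schneider-ideate`). Part 1 (`…PtSurjLift.lean`) removed the global
hypothesis `E(K̄)[p^∞]^{Γ_K} = 0` from the X11b route-R1 Poitou–Tate lift (torsion argument at the
strict prime `𝔮 = 𝔭̄`, finite level). Here: `levelLiftingP_of_finite_anyTorsion` ((P9⁺) for ANY killing
exponent of `E(K̄)[p^∞]^{D_𝔮}`); `levelLiftingAt_of_finite_anyTorsion`, `locSurjAt_of_finite_anyTorsion`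
(atom (P9) `X11b.LocSurjAt`, JSW17 Prop. 3.3.2, WITHOUT `E(K)[p] = 0` and WITHOUT (iv));
`exists_locAtFinset_eq_of_finite_anyTorsion` (the ELEMENT form: every family
`x_v ∈ H¹(⊤ ⊓ D_v, E[p^∞])`, `v ∈ Σ ∪ {𝔭}`, is `(loc_v c)_v` for a global `c` locally trivial at the
finite `v ∤ p` outside `Σ`); `exists_pow_nsmul_fixedPoints_decomp_eq_zero` (the killing exponent at a
degree-one `𝔮 ∣ p`); `ptSurj_of_finite` — **the `hloc` input (P9-𝓒) of the crux's torsion-robust glue**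
(`additiveControlOnTreeAt_of_torsAtoms`) at EVERY frame of `E/ℚ` over an imaginary quadratic `K` with
`p` split, GIVEN the cited `poitouTate_selmerStructure_duality K` and the finiteness of Castella's
`Sel_𝔭̄(K, E[p^∞])` (Milne I 2.8 at the completions is the tree theorem
`localEulerPoincareCharacteristic_adicCompletionEP`, team n1011); `stub_ptSurj_of_facts` — the
REGISTERED stub `stub_ptSurj` (signature verbatim) modulo (a) the cited Poitou–Tate fact, (b) the
finiteness clause of the sibling stub (P6-add-tors) (stated, like that stub, under the crux's Kolyvagin
antecedent) and (c) that antecedent. Why (b)/(c) cannot be dropped: JSW17 prove Prop. 3.3.2 from the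
finiteness of `H¹_{(𝓕^S)_v̄}(K, W)` (their Prop. 3.2.1, under (corank 1) + (sur)); in the tree
`rank E(K) = 1 ∧ #Ш(E/K)[p^∞] < ∞` come from the B6 hypotheses only through the cite-only `kolyvagin`,
so the registered `stub_ptSurj` (no Kolyvagin prefix) is under-typed in the F2 class of item 19178.
CONDITIONAL on the cited fact (hypothesis BY NAME); no `Prop` fact minted; closes nothing by itself;
BSD is not proved by any of this.

References: [JetchevSkinnerWan2017] Prop. 3.2.1, Prop. 3.3.2, §3.3.4 (arXiv:1512.06894 pp. 10–13);
[Howard2004HeegnerKolyvagin] Thm. 2.1.11; [Castella2018] Def. 2.2, Thm. 2.3; [GreenbergLNM1716] §3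
pp. 85–87; [MilneADT2006] I 2.8, 4.10; [SilvermanAEC2009] III.6.4, VII.§3, VIII.§2.
-/

noncomputable section

open scoped Classical
open CategoryTheory Field NumberField IsDedekindDomain
open Literature.NumberTheory.EllipticCurves Literature.NumberTheory.EllipticCurves.GreenbergSelmer
open Literature.NumberTheory.GaloisRepresentations
open Literature.NumberTheory.GaloisRepresentations.DiscreteGaloisModule (SelmerStructure TateDual
  tateDual localTatePairingZMod unramifiedSubgroup)
open Literature.NumberTheory.GaloisCohomology
open scoped ContRepresentation

set_option linter.dupNamespace false

namespace Summit.BirchSwinnertonDyer.BirchSwinnertonDyer.Theorems.SchneiderFreeAdditiveX3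

open Summit.BirchSwinnertonDyer.Rank1Residual.X11b
open Summit.BirchSwinnertonDyer.Rank1Residual.X11b.AcSelmer
open Summit.BirchSwinnertonDyer.Rank1Residual.X11b.LocBridge
open Summit.BirchSwinnertonDyer.Rank1Residual.X11b.Levels

/-! ## §4. (P9⁺), (P9) with an arbitrary killing exponent -/

section Lift

variable {K : Type} [Field K] [NumberField K] (W : WeierstrassCurve K) [W.IsElliptic] (p : ℕ)
  [Fact p.Prime] (𝔭 : HeightOneSpectrum (𝓞 K)) (S : Set (HeightOneSpectrum (𝓞 K)))

/-- **(P9⁺) WITHOUT `E(K)[p] = 0`**: as `levelLiftingP_of_finite_anyTorsion_at`, for ANY exponent `m` with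
`p^m · E(K̄)[p^∞]^{D_𝔮} = 0` and any family killed by `p^{K₀}` — run the lift at the level `K₀ + m`.
[cite: JetchevSkinnerWan2017, Prop. 3.3.2 (arXiv:1512.06894 p. 11)] [cite: Howard2004HeegnerKolyvagin, Thm. 2.1.11] -/
theorem levelLiftingP_of_finite_anyTorsion (T : Finset (Place K))
    (hPT : poitouTate_selmerStructure_duality K) (hK : ∀ w : InfinitePlace K, w.IsComplex)
    {𝔮 : HeightOneSpectrum (𝓞 K)} (h𝔭 : ((p : ℕ) : 𝓞 K) ∈ 𝔭.asIdeal)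
    (h𝔮 : ((p : ℕ) : 𝓞 K) ∈ 𝔮.asIdeal) (hne : 𝔮 ≠ 𝔭)
    (hSp : ∀ v ∈ S, ((p : ℕ) : 𝓞 K) ∉ v.asIdeal)
    (hinf : ∀ w : InfinitePlace K, (Sum.inl w : Place K) ∈ T)
    (hp : ∀ v : HeightOneSpectrum (𝓞 K), ((p : ℕ) : 𝓞 K) ∈ v.asIdeal → (Sum.inr v : Place K) ∈ T)
    (hSig : ∀ v ∈ S, (Sum.inr v : Place K) ∈ T)
    (hbad : ∀ v : HeightOneSpectrum (𝓞 K), ¬ W.HasGoodReductionAt v → (Sum.inr v : Place K) ∈ T)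
    (hfin : Finite ((acStructure (primaryGaloisModule W p) p 𝔮
      {v | (Sum.inr v : Place K) ∈ T ∧ ((p : ℕ) : 𝓞 K) ∉ v.asIdeal}).selmerGroup))
    {m : ℕ} (htor : ∀ Q : W.geomPrimaryTorsion p, (∀ d ∈ decomp 𝔮, d • Q = Q) → p ^ m • Q = 0)
    (K₀ : ℕ) (τ : ∀ v : (insert 𝔭 S : Set (HeightOneSpectrum (𝓞 K))),
      galoisCohomology
        ((primaryGaloisModule W p).toLocal (Sum.inr (v : HeightOneSpectrum (𝓞 K)))) 1)
    (hτ : ∀ v, p ^ K₀ • τ v = 0) :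
    ∃ (N : ℕ) (x : galoisCohomology (W.torsionGaloisModule ((p ^ N : ℕ) : ℤ)) 1),
      x ∈ (upperStructureP W p N 𝔭 S).selmerGroup ∧
        ∀ v : (insert 𝔭 S : Set (HeightOneSpectrum (𝓞 K))),
          galoisCohomology.localization (primaryGaloisModule W p)
            (Sum.inr (v : HeightOneSpectrum (𝓞 K))) 1
            (galoisCohomology.map (primaryInclusion W p N) 1 x) = τ v :=
  levelLiftingP_of_finite_anyTorsion_at W p 𝔭 S T hPT hK h𝔭 h𝔮 hne hSp hinf hp hSig hbad hfin (K₀ + m)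
    (fun Q hQ ↦ by rw [pow_add, mul_smul, htor Q hQ, smul_zero]) τ
    (fun v ↦ by rw [pow_add, mul_comm, mul_smul, hτ v, smul_zero])

/-- **(P9)'s finite-level form `LevelLiftingAt W p 𝔭 Σ` WITHOUT `E(K)[p] = 0`** (the R1 engine's
`levelLiftingAt_of_finite`, credit multr1-p1, `hΓ` replaced by the killing exponent of `E(K̄)[p^∞]^{D_𝔮}`):
extend the family by `0` at `𝔭`, lift with `levelLiftingP_of_finite_anyTorsion`; the lift is strict at `𝔭`
at level `N` because its `p^∞`-localisation there vanishes (propagated condition).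
[cite: JetchevSkinnerWan2017, Prop. 3.3.2 (arXiv:1512.06894 p. 11)] [cite: Castella2018, Def. 2.2, Thm. 2.3 (arXiv:1704.06608 p. 5)] -/
theorem levelLiftingAt_of_finite_anyTorsion (T : Finset (Place K))
    (hPT : poitouTate_selmerStructure_duality K) (hK : ∀ w : InfinitePlace K, w.IsComplex)
    {𝔮 : HeightOneSpectrum (𝓞 K)} (h𝔭 : ((p : ℕ) : 𝓞 K) ∈ 𝔭.asIdeal)
    (h𝔮 : ((p : ℕ) : 𝓞 K) ∈ 𝔮.asIdeal) (hne : 𝔮 ≠ 𝔭)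
    (hSp : ∀ v ∈ S, ((p : ℕ) : 𝓞 K) ∉ v.asIdeal)
    (hinf : ∀ w : InfinitePlace K, (Sum.inl w : Place K) ∈ T)
    (hp : ∀ v : HeightOneSpectrum (𝓞 K), ((p : ℕ) : 𝓞 K) ∈ v.asIdeal → (Sum.inr v : Place K) ∈ T)
    (hSig : ∀ v ∈ S, (Sum.inr v : Place K) ∈ T)
    (hbad : ∀ v : HeightOneSpectrum (𝓞 K), ¬ W.HasGoodReductionAt v → (Sum.inr v : Place K) ∈ T)
    (hfin : Finite ((acStructure (primaryGaloisModule W p) p 𝔮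
      {v | (Sum.inr v : Place K) ∈ T ∧ ((p : ℕ) : 𝓞 K) ∉ v.asIdeal}).selmerGroup))
    {m : ℕ} (htor : ∀ Q : W.geomPrimaryTorsion p, (∀ d ∈ decomp 𝔮, d • Q = Q) → p ^ m • Q = 0) :
    LevelLiftingAt W p 𝔭 S := by
  intro K₀ τ hτ
  have h𝔭S : 𝔭 ∉ S := fun h ↦ hSp 𝔭 h h𝔭
  -- extend the family by `0` at `𝔭`
  let τ' : ∀ v : (insert 𝔭 S : Set (HeightOneSpectrum (𝓞 K))),
      galoisCohomology
        ((primaryGaloisModule W p).toLocal (Sum.inr (v : HeightOneSpectrum (𝓞 K)))) 1 :=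
    fun v ↦ if hv : (v : HeightOneSpectrum (𝓞 K)) ∈ S then τ ⟨v, hv⟩ else 0
  have hτ' : ∀ v, p ^ K₀ • τ' v = 0 := fun v ↦ by
    by_cases hv : (v : HeightOneSpectrum (𝓞 K)) ∈ S
    · simp only [τ', dif_pos hv]; exact hτ ⟨v, hv⟩
    · simp only [τ', dif_neg hv, smul_zero]
  obtain ⟨N, x, hx, hloc⟩ := levelLiftingP_of_finite_anyTorsion W p 𝔭 S T hPT hK h𝔭 h𝔮 hne hSp hinf
    hp hSig hbad hfin htor K₀ τ' hτ'
  refine ⟨N, x, ?_, fun v ↦ ?_⟩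
  · rw [SelmerStructure.mem_selmerGroup_iff] at hx ⊢
    intro v
    by_cases hv : v = Sum.inr 𝔭
    · subst hv
      rw [acLevelStructure_eq_ker_of W p N 𝔭 S (acStructure_self (primaryGaloisModule W p) p 𝔭 S)]
      have h := hloc ⟨𝔭, Set.mem_insert 𝔭 S⟩
      have h0 : τ' ⟨𝔭, Set.mem_insert 𝔭 S⟩ = 0 := by simp only [τ', dif_neg h𝔭S]
      rw [h0, localization_map_one] at h
      exact (AddMonoidHom.mem_ker).2 h
    · have h := hx v
      rwa [upperStructureP_of_ne W p N 𝔭 S hv] at h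
  · have h := hloc ⟨v, Set.mem_insert_of_mem 𝔭 v.2⟩
    have h1 : τ' ⟨v, Set.mem_insert_of_mem 𝔭 v.2⟩ = τ v := by
      simp only [τ', dif_pos v.2]
    rw [h1] at h
    exact h

/-- **Atom (P9) `LocSurjAt W p 𝔭 Σ` WITHOUT `E(K)[p] = 0`** (JSW17 Prop. 3.3.2 on the constructed
objects, regime B2 included), by `locSurjAt_of_levelLifting`. [cite: JetchevSkinnerWan2017, Prop. 3.3.2 and §3.3.4 (arXiv:1512.06894 pp. 11, 13)]
[cite: Castella2018, Thm. 2.3 (arXiv:1704.06608 p. 5)] -/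
theorem locSurjAt_of_finite_anyTorsion (T : Finset (Place K))
    (hPT : poitouTate_selmerStructure_duality K) (hK : ∀ w : InfinitePlace K, w.IsComplex)
    {𝔮 : HeightOneSpectrum (𝓞 K)} (h𝔭 : ((p : ℕ) : 𝓞 K) ∈ 𝔭.asIdeal)
    (h𝔮 : ((p : ℕ) : 𝓞 K) ∈ 𝔮.asIdeal) (hne : 𝔮 ≠ 𝔭) (hS : S.Finite)
    (hSp : ∀ v ∈ S, ((p : ℕ) : 𝓞 K) ∉ v.asIdeal)
    (hinf : ∀ w : InfinitePlace K, (Sum.inl w : Place K) ∈ T)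
    (hp : ∀ v : HeightOneSpectrum (𝓞 K), ((p : ℕ) : 𝓞 K) ∈ v.asIdeal → (Sum.inr v : Place K) ∈ T)
    (hSig : ∀ v ∈ S, (Sum.inr v : Place K) ∈ T)
    (hbad : ∀ v : HeightOneSpectrum (𝓞 K), ¬ W.HasGoodReductionAt v → (Sum.inr v : Place K) ∈ T)
    (hfin : Finite ((acStructure (primaryGaloisModule W p) p 𝔮
      {v | (Sum.inr v : Place K) ∈ T ∧ ((p : ℕ) : 𝓞 K) ∉ v.asIdeal}).selmerGroup))
    {m : ℕ} (htor : ∀ Q : W.geomPrimaryTorsion p, (∀ d ∈ decomp 𝔮, d • Q = Q) → p ^ m • Q = 0) :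
    LocSurjAt W p 𝔭 hS :=
  locSurjAt_of_levelLifting hS (levelLiftingAt_of_finite_anyTorsion W p 𝔭 S T hPT hK h𝔭 h𝔮 hne hSp
    hinf hp hSig hbad hfin htor)

/-! ## §5. The element form (P9-𝓒): prescribed classes at `Σ ∪ {𝔭}` in `H¹(⊤ ⊓ D_v, E[p^∞])` -/

/-- **(P9-𝓒) on the constructed objects, WITHOUT `E(K)[p] = 0`**: for `K` totally complex, the cited
Poitou–Tate fact, `𝔭 ≠ 𝔮` above `p`, a finite `Σ` away from `p`, `T ⊇ ∞ ∪ {v∣p} ∪ Σ ∪ {bad}`, the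
finiteness of Castella's relaxed conjugate group `H¹_{𝓛^{ac,R}_𝔮}(K, E[p^∞])` and a killing exponent of
`E(K̄)[p^∞]^{D_𝔮}`: EVERY family `x_v ∈ H¹(⊤ ⊓ D_v, E[p^∞])`, `v ∈ Σ ∪ {𝔭}`, is `(loc_v c)_v` for a
class `c ∈ H¹(K, E[p^∞])` that is locally trivial at every finite `v ∤ p` outside `Σ` (full
surjectivity, in particular onto the local kernels `∏ ker r_v` of the crux's counting snake lemma).
Inflate to the completions, lift (`levelLiftingP_of_finite_anyTorsion`), push to `H¹(⊤, E[p^∞])`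
(`topEquivH1`), read off the components by injectivity of inflation. [cite: JetchevSkinnerWan2017, Prop. 3.3.2 and §3.3.4 (arXiv:1512.06894 pp. 11, 13)]
[cite: GreenbergLNM1716, §3 pp. 85–86 (`P_E`, `G_E`)] -/
theorem exists_locAtFinset_eq_of_finite_anyTorsion (T : Finset (Place K))
    (hPT : poitouTate_selmerStructure_duality K) (hK : ∀ w : InfinitePlace K, w.IsComplex)
    {𝔮 : HeightOneSpectrum (𝓞 K)} (h𝔭 : ((p : ℕ) : 𝓞 K) ∈ 𝔭.asIdeal)
    (h𝔮 : ((p : ℕ) : 𝓞 K) ∈ 𝔮.asIdeal) (hne : 𝔮 ≠ 𝔭) (hS : S.Finite)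
    (hSp : ∀ v ∈ S, ((p : ℕ) : 𝓞 K) ∉ v.asIdeal)
    (hinf : ∀ w : InfinitePlace K, (Sum.inl w : Place K) ∈ T)
    (hp : ∀ v : HeightOneSpectrum (𝓞 K), ((p : ℕ) : 𝓞 K) ∈ v.asIdeal → (Sum.inr v : Place K) ∈ T)
    (hSig : ∀ v ∈ S, (Sum.inr v : Place K) ∈ T)
    (hbad : ∀ v : HeightOneSpectrum (𝓞 K), ¬ W.HasGoodReductionAt v → (Sum.inr v : Place K) ∈ T)
    (hfin : Finite ((acStructure (primaryGaloisModule W p) p 𝔮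
      {v | (Sum.inr v : Place K) ∈ T ∧ ((p : ℕ) : 𝓞 K) ∉ v.asIdeal}).selmerGroup))
    {m : ℕ} (htor : ∀ Q : W.geomPrimaryTorsion p, (∀ d ∈ decomp 𝔮, d • Q = Q) → p ^ m • Q = 0)
    (x : Π v : ↥(insert 𝔭 hS.toFinset),
      subgroupH1 ((⊤ : Subgroup (absoluteGaloisGroup K)) ⊓ decomp (v : HeightOneSpectrum (𝓞 K)))
        (W.geomPrimaryTorsion p)) :
    ∃ c : W.subgroupH1 p (⊤ : Subgroup (absoluteGaloisGroup K)),
      locAtFinset W p _ c = x ∧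
        ∀ v : HeightOneSpectrum (𝓞 K), ((p : ℕ) : 𝓞 K) ∉ v.asIdeal → v ∉ S →
          c ∈ awayKer ⊤ (W.geomPrimaryTorsion p) v := by
  have hmem : ∀ v : (insert 𝔭 S : Set (HeightOneSpectrum (𝓞 K))),
      (v : HeightOneSpectrum (𝓞 K)) ∈ insert 𝔭 hS.toFinset := fun v ↦
    Finset.mem_insert.2 ((Set.mem_insert_iff.1 v.2).imp id hS.mem_toFinset.2)
  have hmem' : ∀ v : ↥(insert 𝔭 hS.toFinset),
      (v : HeightOneSpectrum (𝓞 K)) ∈ (insert 𝔭 S : Set (HeightOneSpectrum (𝓞 K))) := fun v ↦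
    Set.mem_insert_iff.2 ((Finset.mem_insert.1 v.2).imp id hS.mem_toFinset.1)
  -- inflate to the completions and take a common killing exponent
  let τ : ∀ v : (insert 𝔭 S : Set (HeightOneSpectrum (𝓞 K))),
      galoisCohomology
        ((primaryGaloisModule W p).toLocal (Sum.inr (v : HeightOneSpectrum (𝓞 K)))) 1 :=
    fun v ↦ inflToCompletion (isOpen_stabilizer_geomPrimaryTorsion W p) (v : HeightOneSpectrum (𝓞 K))
      (x ⟨v, hmem v⟩)
  obtain ⟨K₀, hK₀⟩ := exists_pow_nsmul_family_eq_zero (hS.insert 𝔭) τ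
  obtain ⟨N, y, hy, hloc⟩ := levelLiftingP_of_finite_anyTorsion W p 𝔭 S T hPT hK h𝔭 h𝔮 hne hSp hinf
    hp hSig hbad hfin htor K₀ τ hK₀
  refine ⟨topEquivH1 (isOpen_stabilizer_geomPrimaryTorsion W p)
      (galoisCohomology.map (primaryInclusion W p N) 1 y), ?_, fun v hpv hvS ↦ ?_⟩
  · funext v
    apply inflToCompletion_injective (isOpen_stabilizer_geomPrimaryTorsion W p)
      (v : HeightOneSpectrum (𝓞 K))
    rw [locAtFinset_apply, inflToCompletion_resOfLe_topEquivH1]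
    have h := hloc ⟨v, hmem' v⟩
    exact h
  · exact ((topEquivH1_mem_awayKer_iff v _).trans (localization_inr_eq_zero_iff _ v _).symm).mpr
      (localization_map_primaryInclusion_eq_zero_of_mem_upperStructureP W p N 𝔭 S hy h𝔭 hpv hvS)

end Lift
/-! ## §6. The crux's (P9-𝓒) input for `E/ℚ` over an imaginary quadratic `K` -/

section Crux

variable (W : WeierstrassCurve ℚ) [W.IsElliptic] [W.IsGloballyMinimal] (p : ℕ) [Fact p.Prime]
  {K : Type} [Field K] [NumberField K]

/-- **A killing exponent of `E(K̄)[p^∞]^{D_𝔮}` at a degree-one `𝔮 ∣ p`**: that group embeds into the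
finite `E(K_𝔮)[p^∞] ≅ E(ℚ_p)[p^∞]` (Galois descent `natCard_fixedPoints_decomp_le_natCard_primaryComponent`,
finiteness `finite_and_natCard_primaryComponent_adicCompletion_eq_padic`). [cite: SilvermanAEC2009, Cor. III.6.4(b) and VII.§3 (finiteness of torsion over a `p`-adic field)] -/
theorem exists_pow_nsmul_fixedPoints_decomp_eq_zero (𝔮 : HeightOneSpectrum (𝓞 K))
    (h𝔮 : ((p : ℕ) : 𝓞 K) ∈ 𝔮.asIdeal) (he : 𝔮.asIdeal.ramificationIdx (𝓞 ℚ) = 1)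
    (hf : 𝔮.asIdeal.inertiaDeg (𝓞 ℚ) = 1) :
    ∃ m : ℕ, ∀ Q : (W.baseChange K).geomPrimaryTorsion p, (∀ d ∈ decomp 𝔮, d • Q = Q) →
      p ^ m • Q = 0 := by
  haveI hEK : (W.baseChange K).IsElliptic := by rw [WeierstrassCurve.baseChange]; infer_instance
  haveI := (finite_and_natCard_primaryComponent_adicCompletion_eq_padic W p 𝔮 h𝔮 he hf).1
  haveI hfinF : Finite (FixedPoints.addSubgroup ↥(decomp 𝔮) ((W.baseChange K).geomPrimaryTorsion p)) :=
    (natCard_fixedPoints_decomp_le_natCard_primaryComponent (W.baseChange K) p 𝔮).1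
  set F := FixedPoints.addSubgroup ↥(decomp 𝔮) ((W.baseChange K).geomPrimaryTorsion p) with hF
  haveI : Finite (AddCommGroup.primaryComponent F p) := inferInstance
  obtain ⟨m, hm⟩ := exists_pow_nsmul_eq_zero_of_finite_primaryComponent p (A := F)
  refine ⟨m, fun Q hQ ↦ ?_⟩
  have hQF : Q ∈ F := (FixedPoints.mem_addSubgroup _ _ Q).mpr fun d ↦ hQ d d.2
  obtain ⟨j, hj⟩ := (AddCommGroup.mem_primaryComponent (G := (W.baseChange K).geomPoints)).mp Q.2
  have hjQ : p ^ j • Q = 0 := Subtype.ext (by rw [AddSubgroupClass.coe_nsmul, hj]; rfl)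
  have hjF : p ^ j • (⟨Q, hQF⟩ : F) = 0 := Subtype.ext hjQ
  have hmF := hm j ⟨Q, hQF⟩ hjF
  exact congrArg Subtype.val hmF

/-- **(P9-𝓒) — the Poitou–Tate surjectivity input `hloc` of the torsion-robust glue
`additiveControlOnTreeAt_of_torsAtoms` / `natCard_endInvariants_mul_natCard_resKer_eq_nPlus` — at EVERY
frame (any global torsion `g`, any local torsion `t`)**, for `E/ℚ` over an imaginary quadratic `K` with
`p` split, `𝔭 ≠ 𝔮` above `p`: GIVEN the cited Poitou–Tate fact for `K` and the finiteness of Castella's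
Selmer group `Sel_𝔮(K, E[p^∞])` for the CONJUGATE prime, every family of local classes at
`T = {𝔭} ∪ Σ(N⁺)` lifts to a global class locally trivial away from `T ∪ {v ∣ p}`. Milne I 2.8 at the
completions is the tree theorem `localEulerPoincareCharacteristic_adicCompletionEP` (team n1011).
[cite: JetchevSkinnerWan2017, Prop. 3.3.2 and §3.3.4 (arXiv:1512.06894 pp. 11, 13)]
[cite: MilneADT2006, Ch. I, Thm. 4.10(b)] -/
theorem ptSurj_of_finite (hK : IsImaginaryQuadratic K) (hsplit : SplitsIn K p)
    (hPT : poitouTate_selmerStructure_duality K) {𝔭 𝔮 : HeightOneSpectrum (𝓞 K)}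
    (h𝔭 : ((p : ℕ) : 𝓞 K) ∈ 𝔭.asIdeal) (h𝔮 : ((p : ℕ) : 𝓞 K) ∈ 𝔮.asIdeal) (hne : 𝔮 ≠ 𝔭)
    (hfin : Finite (selmerAcBase (W.baseChange K) p 𝔮 ∅)) (κ : ZpExtension K p) :
    ∀ x : Π v : ↥(insert 𝔭 (nPlusPlaces_finite (W := W) (p := p) (K := K) hK.1).toFinset),
        Literature.NumberTheory.EllipticCurves.subgroupH1
          ((⊤ : Subgroup (absoluteGaloisGroup K)) ⊓ decomp (v : HeightOneSpectrum (𝓞 K)))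
          ((W.baseChange K).geomPrimaryTorsion p),
      (∀ v : ↥(insert 𝔭 (nPlusPlaces_finite (W := W) (p := p) (K := K) hK.1).toFinset),
        x v ∈ localKer κ.kerSubgroup ((W.baseChange K).geomPrimaryTorsion p)
          (v : HeightOneSpectrum (𝓞 K))) →
        ∃ c : (W.baseChange K).subgroupH1 p (⊤ : Subgroup (absoluteGaloisGroup K)),
          locAtFinset (W.baseChange K) p _ c = x ∧
          ∀ v : HeightOneSpectrum (𝓞 K), ((p : ℕ) : 𝓞 K) ∉ v.asIdeal → v ∉ (∅ : Set _) →
            v ∉ insert 𝔭 (nPlusPlaces_finite (W := W) (p := p) (K := K) hK.1).toFinset →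
              c ∈ awayKer ⊤ ((W.baseChange K).geomPrimaryTorsion p) v := by
  intro x _
  haveI : IsTotallyComplex K := hK.2
  haveI hEK : (W.baseChange K).IsElliptic := by rw [WeierstrassCurve.baseChange]; infer_instance
  haveI := hfin
  -- finiteness of the relaxed conjugate group `Sel_𝔮^R(K, E[p^∞])`, `R = {v ∈ T : v ∤ p}`
  have hfin0 : Finite (acStructure (primaryGaloisModule (W.baseChange K) p) p 𝔮
      (∅ : Set (HeightOneSpectrum (𝓞 K)))).selmerGroup := by
    refine Nat.finite_of_card_ne_zero ?_
    rw [← natCard_selmerAcBase_eq_natCard_selmerGroup (W.baseChange K) p 𝔮 ∅]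
    exact Nat.card_pos.ne'
  have hfinR : Finite (acStructure (primaryGaloisModule (W.baseChange K) p) p 𝔮
      {v | (Sum.inr v : Place K) ∈ exceptionalPlaces W K p hK.1 ∧
        ((p : ℕ) : 𝓞 K) ∉ v.asIdeal}).selmerGroup :=
    finite_selmerGroup_acStructure_of_finite_empty _ p 𝔮 _ (finite_relaxationSet hK.1) hfin0
      fun v _ hpv ↦ finite_galoisCohomology_one_primary_toLocal (W.baseChange K) p v
        (localEulerPoincareCharacteristic_adicCompletionEP K v) hpv
  -- the killing exponent of `E(K̄)[p^∞]^{D_𝔮}` (`𝔮` has degree one since `p` splits)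
  obtain ⟨he𝔮, hf𝔮⟩ := degreeOne_of_splitsIn hK.1 hsplit h𝔮
  obtain ⟨m, hm⟩ := exists_pow_nsmul_fixedPoints_decomp_eq_zero W p 𝔮 h𝔮 he𝔮 hf𝔮
  obtain ⟨c, hc, haway⟩ := exists_locAtFinset_eq_of_finite_anyTorsion (W.baseChange K) p 𝔭
    (nPlusPlaces W K p) (exceptionalPlaces W K p hK.1) hPT (fun w ↦ IsTotallyComplex.isComplex w)
    h𝔭 h𝔮 hne (nPlusPlaces_finite (W := W) (p := p) hK.1) (fun v hv ↦ hv.1)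
    (inl_mem_exceptionalPlaces hK.1) (fun v hv ↦ inr_mem_exceptionalPlaces_of_mem hK.1 hv)
    (fun v hv ↦ inr_mem_exceptionalPlaces_of_mem_nPlusPlaces hK.1 hv)
    (fun v hv ↦ inr_mem_exceptionalPlaces_of_not_hasGoodReductionAt hK.1 hv) hfinR hm x
  refine ⟨c, hc, fun v hpv _ hvT ↦ haway v hpv fun hvS ↦ hvT ?_⟩
  exact Finset.mem_insert.2 (Or.inr ((nPlusPlaces_finite (W := W) (p := p) hK.1).mem_toFinset.2 hvS))

end Crux

/-! ## §7. The registered stub modulo the cited fact and the finiteness clause of (P6-add-tors) -/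

section Stub

open WeierstrassCurve Literature.NumberTheory.EllipticCurves.ModularForms
  Literature.NumberTheory.EllipticCurves.Rank1Residual
  Literature.NumberTheory.EllipticCurves.Rank1Residual.Typed
  Summit.BirchSwinnertonDyer.Rank1Residual
  Summit.BirchSwinnertonDyer.BirchSwinnertonDyer.Theorems.SchneiderFree
  Summit.BirchSwinnertonDyer.BirchSwinnertonDyer.Theorems.SchneiderFreeControlAtoms

/-- **The registered stub `stub_ptSurj` (skeleton v3-K of crux `AnticycControlAdditiveK`, signature
VERBATIM as the conclusion) DISCHARGED MODULO (a) the cited Poitou–Tate duality for Selmer structures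
(`poitouTate_selmerStructure_duality`, Milne ADT I 4.10(b) / Howard 2004 Thm. 2.1.11, a hypothesis BY
NAME) and (b) the FINITENESS clause of the sibling stub (P6-add-tors) — `Sel_𝔭(K, E[p^∞])` finite at every
B6 frame, itself stated under the Kolyvagin antecedent of the crux — and (c) that antecedent.** At a frame
with strict prime `𝔭`, (b) is used at the CONJUGATE prime `𝔭̄` (also of degree one, `p` being split by
the Heegner hypothesis and `p ∣ N_E`), exactly as in JSW17's proof of Prop. 3.3.2 ("reversing the roles of
`v` and `v̄`"). No hypothesis on `E(K)[p]` (regime B2 included) or on `E(K_𝔭)[p]` (`t_p ≥ 1` included):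
`ptSurj_of_finite`. This is a CONDITIONAL discharge (the stub's own signature carries neither (a) nor
(b)); see the seat's finding on the item for why (P9) cannot be had in-tree without the rank-one input.
[cite: JetchevSkinnerWan2017, Prop. 3.3.2 and Prop. 3.2.1 (arXiv:1512.06894 pp. 10–11)]
[cite: MilneADT2006, Ch. I, Thm. 4.10(b)] [cite: Howard2004HeegnerKolyvagin, Thm. 2.1.11 (arXiv:1202.6340 p. 6)] -/
theorem stub_ptSurj_of_facts
    (hPT : ∀ (K : Type) [Field K] [NumberField K], poitouTate_selmerStructure_duality K)
    (h6 : (∀ (N : ℕ) [NeZero N] (W : WeierstrassCurve ℚ) (K : Type) [Field K] [NumberField K],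
        Literature.NumberTheory.EllipticCurves.kolyvagin N W K) →
      ∀ (W : WeierstrassCurve ℚ) [W.IsElliptic] [W.IsGloballyMinimal] (p : ℕ) [Fact p.Prime],
      W.analyticRank = 1 → p ≠ 2 → ClassX3 W p → Additive.SubSemistableTwist W p →
      ∀ (N : ℕ) [NeZero N] (K : Type) [Field K] [NumberField K]
        (Dt : ModularParametrizationData W N) (H : HeegnerDatum N (NumberField.discr K)) (ι : K →+* ℂ)
        (P : (W.baseChange K).toAffine.Point),
        W.analyticRank = 1 → Additive.N10.Locus W p → W.conductorNorm ℤ = N →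
        ∀ hK : IsImaginaryQuadratic K,
        Odd (NumberField.discr K) → ¬ p ∣ Units.torsionOrder K → SatisfiesHeegnerHypothesis N K →
        (W.quadraticTwist (NumberField.discr K : ℚ)).entireLFunction 1 ≠ 0 →
        WeierstrassCurve.Affine.Point.map ι.toRatAlgHom P = heegnerPointComplex Dt H →
        ¬ IsOfFinAddOrder P →
        ∀ (κ : ZpExtension K p), κ.IsAnticyclotomic →
          ∀ (γ : Field.absoluteGaloisGroup K) [Fact (κ.IsTopGenerator γ)]
            (𝔭 : HeightOneSpectrum (𝓞 K)) (h𝔭 : ((p : ℕ) : 𝓞 K) ∈ 𝔭.asIdeal)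
            (he : 𝔭.asIdeal.ramificationIdx (𝓞 ℚ) = 1) (hf : 𝔭.asIdeal.inertiaDeg (𝓞 ℚ) = 1),
            Finite (selmerAcBase (W.baseChange K) p 𝔭 ∅))
    (hKo : ∀ (N : ℕ) [NeZero N] (W : WeierstrassCurve ℚ) (K : Type) [Field K] [NumberField K],
      Literature.NumberTheory.EllipticCurves.kolyvagin N W K) :
    ∀ (W : WeierstrassCurve ℚ) [W.IsElliptic] [W.IsGloballyMinimal] (p : ℕ) [Fact p.Prime],
      W.analyticRank = 1 → p ≠ 2 → ClassX3 W p → Additive.SubSemistableTwist W p →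
      ∀ (N : ℕ) [NeZero N] (K : Type) [Field K] [NumberField K]
        (Dt : ModularParametrizationData W N) (H : HeegnerDatum N (NumberField.discr K)) (ι : K →+* ℂ)
        (P : (W.baseChange K).toAffine.Point),
        W.analyticRank = 1 → Additive.N10.Locus W p → W.conductorNorm ℤ = N →
        ∀ hK : IsImaginaryQuadratic K,
        Odd (NumberField.discr K) → ¬ p ∣ Units.torsionOrder K → SatisfiesHeegnerHypothesis N K →
        (W.quadraticTwist (NumberField.discr K : ℚ)).entireLFunction 1 ≠ 0 →
        WeierstrassCurve.Affine.Point.map ι.toRatAlgHom P = heegnerPointComplex Dt H →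
        ¬ IsOfFinAddOrder P →
        ∀ (κ : ZpExtension K p), κ.IsAnticyclotomic →
          ∀ (γ : Field.absoluteGaloisGroup K) [Fact (κ.IsTopGenerator γ)]
            (𝔭 : HeightOneSpectrum (𝓞 K)) (h𝔭 : ((p : ℕ) : 𝓞 K) ∈ 𝔭.asIdeal)
            (he : 𝔭.asIdeal.ramificationIdx (𝓞 ℚ) = 1) (hf : 𝔭.asIdeal.inertiaDeg (𝓞 ℚ) = 1),
            (∀ x : Π v : ↥(insert 𝔭 (nPlusPlaces_finite (W := W) (p := p) (K := K) hK.1).toFinset),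
                  Literature.NumberTheory.EllipticCurves.subgroupH1
                    ((⊤ : Subgroup (absoluteGaloisGroup K)) ⊓ decomp (v : HeightOneSpectrum (𝓞 K)))
                    ((W.baseChange K).geomPrimaryTorsion p),
                (∀ v : ↥(insert 𝔭 (nPlusPlaces_finite (W := W) (p := p) (K := K) hK.1).toFinset),
                  x v ∈ localKer κ.kerSubgroup ((W.baseChange K).geomPrimaryTorsion p)
                    (v : HeightOneSpectrum (𝓞 K))) →
                  ∃ c : (W.baseChange K).subgroupH1 p (⊤ : Subgroup (absoluteGaloisGroup K)),
                    locAtFinset (W.baseChange K) p _ c = x ∧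
                    ∀ v : HeightOneSpectrum (𝓞 K), ((p : ℕ) : 𝓞 K) ∉ v.asIdeal → v ∉ (∅ : Set _) →
                      v ∉ insert 𝔭 (nPlusPlaces_finite (W := W) (p := p) (K := K) hK.1).toFinset →
                        c ∈ awayKer ⊤ ((W.baseChange K).geomPrimaryTorsion p) v) := by
  intro W _ _ p _ hr hp2 hX hS N _ K _ _ Dt H ι P hr' hloc hN hK hodd hunit hHe hL1 hP hnt κ hκ γ _ 𝔭
    h𝔭 he hf
  have hpN : p ∣ W.conductorNorm ℤ := dvd_conductorNorm_of_n10Locus hloc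
  have hsplit : SplitsIn K p := splitsIn_of_satisfiesHeegnerHypothesis hN hHe hpN
  -- the conjugate prime `𝔮 = 𝔭̄`, also of degree one
  obtain ⟨σ, 𝔮, -, hne, h𝔮, -⟩ := LocalIndexTransport.exists_conj_prime_of_splitsIn K p hK.1 hsplit h𝔭
  obtain ⟨he𝔮, hf𝔮⟩ := degreeOne_of_splitsIn hK.1 hsplit h𝔮
  -- (P6-add-tors), finiteness clause, at the conjugate frame
  have hfin : Finite (selmerAcBase (W.baseChange K) p 𝔮 ∅) :=
    h6 hKo W p hr hp2 hX hS N K Dt H ι P hr' hloc hN hK hodd hunit hHe hL1 hP hnt κ hκ γ 𝔮 h𝔮 he𝔮 hf𝔮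
  exact ptSurj_of_finite W p hK hsplit (hPT K) h𝔭 h𝔮 hne hfin κ

end Stub

end Summit.BirchSwinnertonDyer.BirchSwinnertonDyer.Theorems.SchneiderFreeAdditiveX3

end
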